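import Summits.BirchSwinnertonDyer.BirchSwinnertonDyer.Theorems.KatoDescentPotSupersingularWildFineSelmerSupersingularCMAnchor
import Summits.BirchSwinnertonDyer.BirchSwinnertonDyer.Theorems.KatoDescentPotSupersingularWildFineSelmerSmallConductorAnchor
import Literature.NumberTheory.EllipticCurves.BDKim2013.SignedCharValueRankZero
import Literature.NumberTheory.EllipticCurves.Kobayashi2003.SignedSelmerTorsion
import HarnessLib

/-!
# The SUPERSINGULAR UNIT-ANCHOR road to the Conj-A crux `WildFineSelmerCoatesSujatha`
# (item stmt-BirchSwinnertonDyer-19386; route `KatoDescentPotSupersingular`, rung K9, cell `bsd-potss`):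
# B. D. Kim's signed Euler characteristic at a GOOD SUPERSINGULAR (`a_p = 0`) anchor — CM OR NOT —
# ⟹ `Sel^ε(W′/ℚ_∞)[p]` finite ⟹ (A) at `(W′,p)` ⟹ (A) at the ♯ row ⟹ Upper
# (a `--supports … --as helper` file; seat `bsd-potss-k9-c4` g5; ROUTE-FREE; nothing booked, BSD is not
# proved by any of this)

WHY. The ordinary unit-anchor road of seat g4 (`…WildFineSelmerOrdinaryUnitAnchor.lean`, p457401:
Greenberg's Thm. 4.1 — five integers ⟹ `μ(X(E′/ℚ_∞)) = 0`) has an exact supersingular twin once the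
"± ⊇ fine" bridge is in the kernel (this seat, p466275): for `E′/ℚ` with GOOD SUPERSINGULAR reduction
at an odd `p` and `a_p = 0` (no CM, no image hypothesis), Kobayashi's Thm. 1.2 (tree fact
`Kobayashi2003.thm12_signedSelmerDual_finite_torsion`: `X^ε` is `Λ`-torsion) and B. D. Kim's signed
`Γ`-Euler characteristic (tree fact `BDKim2013.cor315_signedCharValue_rankZero`:
`f^ε(0) ∼ #Sel_{p^∞}(E′/ℚ) · ∏ c_ℓ` when `Sel_{p^∞}(E′/ℚ)` is finite) give: `rank E′(ℚ) = 0`,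
`#Ш(E′)[p^∞] = 1`, `p ∤ ∏ c_ℓ(E′)` ⟹ `f^ε(0) ∈ ℤ_pˣ` ⟹ `μ(X^ε) = 0` ⟹ `Sel^ε(E′/ℚ_∞)[p]` finite
(p467612 §1) ⟹ (A) at `(E′,p)` (p466275) ⟹ (A) at a congruent row (Lim–Sujatha) ⟹ Upper. THREE
integers instead of five (no torsion or `#Ẽ(𝔽_p)` factor: `E′(ℚ_p)` has no `p`-torsion at a
supersingular `p`). Reach (census of seat k8t-c4 g4, `HOME/k8t-c4/K9-19386-anchor-census-g4.tsv`,
column «± unit»): 63 rows of the crux with such partners at data level, 11 of them ♯ — beyond the 8 ♯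
rows of the ordinary road; no number is an input here.

* §1 `finite_signedSelmerInfty_pTorsion_of_signedUnitData` — the three-integer criterion (both signs,
  every cyclotomic `κ`); `…_of_analyticRankZero_…` (printed form: `r_an(E′) = 0`, `p ∤ #Ш(E′)`).
* §2 `conjA_rat_of_signedUnitData` — (A) at `(E′,p)` for every cyclotomic `κ`.
* §3 the ROW ROADS: **`missingUpperBoundAt_wild_of_supersingularUnitAnchor`** (Upper at a ♯ row `W`
  ⟸ {LS18, Kato fine reading, Kobayashi 1.2, Kim 3.15, GZK, modularity} + ONE congruent good
  supersingular `a₃ = 0` anchor with `rank = 0`, `#Ш[3^∞] = 1`, `3 ∤ Tam`), `…_analytic`, and the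
  SMALL-CONDUCTOR form `…_smallConductor…` (`N_{E′} < 5000`: `#Ш(E′) = Ш_an(E′)` by Creutz–Miller,
  bsd.S31, g4's `natCard_sha_eq_of_conductor_lt_of_shaAn_eq`); class form
  `wildFineSelmerCoatesSujatha_of_supersingularUnitAnchorCertificates`.

HONEST FRAMING: conditional-results on the displayed named facts (all published theorems already typed
in the tree; no new fact); the per-row data are hypotheses (data of record, not kernel inputs); items
19386/19197 are NOT closed; class-wide the crux remains Coates–Sujatha (A), a named open problem.
References: [BDKim2013] Cor. 3.15 (p. 199) = Thm. 1.2; [Kobayashi2003] Thm. 1.2, Def. 1.1;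
[CoatesSujatha2005] §3; [LimSujatha2018] §3 Prop. 3.2; [Kato2004Asterisque] Thm. 14.5 (3), Prop. 14.16
(2); [GreenbergLNM1716] §1 p. 54, §4 Thm. 4.1 (the ordinary twin); [CreutzMiller2012] Thm. 1.1.
-/

set_option autoImplicit false
-- sibling precedent (`KatoDescentPotSupersingularAssembly.lean`): the directory name repeats the summit name
set_option linter.dupNamespace false

noncomputable section

open scoped Classical

universe u

namespace Summit.BirchSwinnertonDyer.BirchSwinnertonDyer.Theorems.WildFineSelmerSupersingularUnitAnchor

open NumberField IsDedekindDomain Field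
open WeierstrassCurve Literature.NumberTheory.EllipticCurves
  Literature.NumberTheory.EllipticCurves.IwasawaAlgebra
  Literature.NumberTheory.EllipticCurves.Rank1Residual
  Literature.NumberTheory.EllipticCurves.Rank1Residual.Typed
  Literature.NumberTheory.EllipticCurves.Kobayashi2003 Literature.NumberTheory.EllipticCurves.ZpExtension
  Summit.BirchSwinnertonDyer.Rank1Residual Summit.BirchSwinnertonDyer.Rank1Residual.Additive
  Summit.BirchSwinnertonDyer.Rank1Residual.O6
  Summit.BirchSwinnertonDyer.BirchSwinnertonDyer.Theorems

/-! ## §1 Three integers ⟹ `Sel^ε(E/ℚ_∞)[p]` finite at a good supersingular `a_p = 0` prime -/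

/-- **The supersingular unit criterion, in the kernel below Kobayashi 1.2 and Kim 3.15.** Let `E/ℚ`
be given by a globally minimal `W`, `p` an ODD prime of good reduction with `a_p = 0`, and assume
`rank E(ℚ) = 0`, `#Ш(E/ℚ)[p^∞] = 1`, `p ∤ ∏_ℓ c_ℓ(E)`. Then for every cyclotomic `ℤ_p`-extension datum
`κ` and every sign `ε`, the `p`-torsion `Sel^ε(E/ℚ_∞)[p]` is finite (indeed `μ(X^ε) = 0`): with `γ` a
topological generator and `X^ε` the tree's datum, Kobayashi 1.2 (`h12`) makes `X^ε` torsion, a generator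
`f` of `char X^ε` has `f(0) = u · p^{ord_p ∏ c_ℓ} · #Sel_{p^∞}(E/ℚ) = u` (Kim, `hKim`; in rank `0`
`#Sel_{p^∞}(E/ℚ) = #Ш[p^∞] = 1`), a unit, and p467612's
`finite_signedSelmerInfty_pTorsion_of_charIdeal_eq_span_of_isUnit_coeff` concludes.
[cite: BDKim2013, Cor. 3.15 (p. 199)] [cite: Kobayashi2003, Thm. 1.2] [cite: GreenbergLNM1716, §1 p. 54] -/
theorem finite_signedSelmerInfty_pTorsion_of_signedUnitData
    (h12 : Kobayashi2003.thm12_signedSelmerDual_finite_torsion)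
    (hKim : BDKim2013.cor315_signedCharValue_rankZero)
    (W : WeierstrassCurve ℚ) [W.IsElliptic] [W.IsGloballyMinimal] {p : ℕ} [Fact p.Prime]
    (hp : p ≠ 2) (hgood : W.HasGoodReductionAtPrime p) (hap : W.frobeniusTrace p = 0)
    (hrank : W.mordellWeilRank = 0) (hsha : Nat.card (AddCommGroup.primaryComponent W.sha p) = 1)
    (htam : ¬ p ∣ W.tamagawaProduct) (κ : ZpExtension ℚ p) (hκ : κ.IsCyclotomic) (ε : ℤˣ) :
    Set.Finite {s : signedSelmerInfty W κ ε | p • s = 0} := by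
  -- `E(ℚ)` finite, `#Sel_{p^∞}(E/ℚ) = #Ш[p^∞] = 1`
  haveI hfinE : Finite W.toAffine.Point := W.mordellWeilRank_eq_zero_iff_finite.mp hrank
  have hcardSel : Nat.card (W.selmerGroupPInfty p) = 1 := by
    rw [W.natCard_selmerGroupPInfty_eq_natCard_primaryComponent_sha p, hsha]
  have hSel : Finite (W.selmerGroupPInfty p) :=
    Nat.finite_of_card_ne_zero (by rw [hcardSel]; exact one_ne_zero)
  -- the datum, torsion (Kobayashi 1.2), a generator of its characteristic ideal
  obtain ⟨γ, hγ⟩ : ∃ γ : absoluteGaloisGroup ℚ, κ.IsTopGenerator γ := κ.surjective (Multiplicative.ofAdd 1)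
  set D : SignedSelmerDualData W κ γ ε := signedSelmerDualData W κ ε hγ with hD
  obtain ⟨hfg, hT⟩ := h12 W p hp hgood hap κ γ hκ hγ ε D
  haveI := hfg
  haveI : (Module.charIdeal (IwasawaAlgebra p) D.X).IsPrincipal := charIdeal_isPrincipal_holds p D.X
  obtain ⟨f, hf⟩ := Submodule.IsPrincipal.principal (Module.charIdeal (IwasawaAlgebra p) D.X)
  have hf' : D.charIdeal = Ideal.span {f} := hf
  -- Kim: `f(0) = u · p^{v_p(Tam)} · #Sel = u`
  obtain ⟨u, hu⟩ := hKim W p hp hgood hap κ γ hκ hγ ε D hT f hf' hSel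
  rw [padicValNat.eq_zero_of_not_dvd htam, pow_zero, mul_one, hcardSel, Nat.cast_one, mul_one]
    at hu
  have hunit : IsUnit (PowerSeries.constantCoeff f) := by
    rw [PadicInt.isUnit_iff, ← PadicInt.padic_norm_e_of_padicInt, hu, PadicInt.padic_norm_e_of_padicInt]
    exact PadicInt.isUnit_iff.mp (Units.isUnit u)
  exact WildFineSelmerSupersingularCMAnchor.finite_signedSelmerInfty_pTorsion_of_charIdeal_eq_span_of_isUnit_coeff
    W κ ε hγ hT hf' ⟨0, by rwa [PowerSeries.coeff_zero_eq_constantCoeff_apply]⟩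

/-- Variant with the data read off `ord_{s=1} L(E,s) = 0` and ONE integer: `r_an(E) = 0` (so `E(ℚ)` and
`Ш(E/ℚ)` are finite by Gross–Zagier–Kolyvagin, `hGZK`) and `p ∤ #Ш(E/ℚ)`, with `p ∤ ∏ c_ℓ`.
[cite: BDKim2013, Cor. 3.15 (p. 199)] [cite: Kobayashi2003, Thm. 1.2] -/
theorem finite_signedSelmerInfty_pTorsion_of_analyticRankZero_of_signedUnitData
    (h12 : Kobayashi2003.thm12_signedSelmerDual_finite_torsion)
    (hKim : BDKim2013.cor315_signedCharValue_rankZero)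
    (hGZK : rank_eq_analyticRank_of_analyticRank_le_one)
    (W : WeierstrassCurve ℚ) [W.IsElliptic] [W.IsGloballyMinimal] {p : ℕ} [Fact p.Prime]
    (hp : p ≠ 2) (hgood : W.HasGoodReductionAtPrime p) (hap : W.frobeniusTrace p = 0)
    (hr : W.analyticRank = 0) (hsha : ¬ p ∣ Nat.card W.sha) (htam : ¬ p ∣ W.tamagawaProduct)
    (κ : ZpExtension ℚ p) (hκ : κ.IsCyclotomic) (ε : ℤˣ) :
    Set.Finite {s : signedSelmerInfty W κ ε | p • s = 0} := by
  obtain ⟨hmw, hfin⟩ := hGZK W (by rw [hr]; exact zero_le_one)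
  haveI : Finite W.sha := hfin
  have hrank : W.mordellWeilRank = 0 := by rw [hmw, hr]
  have h1 : Nat.card (AddCommGroup.primaryComponent W.sha p) = 1 := by
    rw [card_addPrimaryComponent_eq_pow p, Nat.factorization_eq_zero_of_not_dvd hsha, pow_zero]
  exact finite_signedSelmerInfty_pTorsion_of_signedUnitData h12 hKim W hp hgood hap hrank h1 htam κ hκ ε

/-! ## §2 (A) at `(E′, p)` from the signed unit data -/

/-- **(A) at `(E,p)` for every cyclotomic `κ` from the supersingular unit data** (§1 at the sign `+`,
then p466275/p467612's `conjA_rat_of_finite_signedSelmerInfty_pTorsion'`).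
[cite: CoatesSujatha2005, §3 (Conjecture A)] [cite: BDKim2013, Cor. 3.15] [cite: Kobayashi2003, Thm. 1.2] -/
theorem conjA_rat_of_signedUnitData (h12 : Kobayashi2003.thm12_signedSelmerDual_finite_torsion)
    (hKim : BDKim2013.cor315_signedCharValue_rankZero)
    (W : WeierstrassCurve ℚ) [W.IsElliptic] [W.IsGloballyMinimal] {p : ℕ} [Fact p.Prime]
    (hp : p ≠ 2) (hgood : W.HasGoodReductionAtPrime p) (hap : W.frobeniusTrace p = 0)
    (hrank : W.mordellWeilRank = 0) (hsha : Nat.card (AddCommGroup.primaryComponent W.sha p) = 1)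
    (htam : ¬ p ∣ W.tamagawaProduct) :
    ∀ (κ : ZpExtension ℚ p), κ.IsCyclotomic →
      ∃ (γ : absoluteGaloisGroup ℚ) (D : W.FineSelmerDualData κ γ),
        Module.Finite ℤ_[p] (RestrictScalars ℤ_[p] (IwasawaAlgebra p) D.X) :=
  WildFineSelmerSupersingularCMAnchor.conjA_rat_of_finite_signedSelmerInfty_pTorsion' W 1 fun κ hκ ↦
    finite_signedSelmerInfty_pTorsion_of_signedUnitData h12 hKim W hp hgood hap hrank hsha htam κ hκ 1

/-! ## §3 The row roads: Upper at a ♯ row from ONE congruent good-supersingular unit anchor -/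

/-- **THE SUPERSINGULAR UNIT-ANCHOR ROAD, row form (K9 currency).** Let `W/ℚ` be a row of the Conj-A
crux of route K9: globally minimal, `r_an = 0`, `ClassO6 W 3`, `W[3]` irreducible. Suppose ONE globally
minimal `W′/ℚ` is given with `W′[3] ≃ W[3]` (`O6.ModPCongruent W′ W 3`), GOOD SUPERSINGULAR at `3` with
`a₃(W′) = 0`, and the three integers `rank E′(ℚ) = 0`, `#Ш(E′/ℚ)[3^∞] = 1`, `3 ∤ ∏ c_ℓ(E′)`. Then
`ord₃ #Ш(E) ≤ ord₃ #Ш(E)_an` (`MissingUpperBoundAt W 3`) — below Lim–Sujatha (`hLS`, p445851), Kato's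
fine-Selmer reading (`hKatoA`, p420034), Kobayashi 1.2 (`h12`), Kim 3.15 (`hKim`), GZK, modularity. No
CM, no image condition on the anchor. [cite: BDKim2013, Cor. 3.15 (p. 199)] [cite: Kobayashi2003, Thm. 1.2]
[cite: LimSujatha2018, §3 Prop. 3.2] [cite: Kato2004Asterisque, Thm. 14.5 (3), Prop. 14.16 (2)] -/
theorem missingUpperBoundAt_wild_of_supersingularUnitAnchor
    (hLS : LimSujatha2018.prop32_fineSelmerDual_moduleFinite_iff_of_torsionIso)
    (hKatoA :
      Kato2004.rankZero_padicValNat_sha_add_padicValNat_tamagawa_le_of_additive_potGood_of_irreducible_of_fineSelmerDual_fg)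
    (h12 : Kobayashi2003.thm12_signedSelmerDual_finite_torsion)
    (hKim : BDKim2013.cor315_signedCharValue_rankZero)
    (hGZK : rank_eq_analyticRank_of_analyticRank_le_one) (hmod : hasEntireLFunction_rat)
    (W : WeierstrassCurve ℚ) [W.IsElliptic] [W.IsGloballyMinimal] [Fact (3 : ℕ).Prime]
    (hr : W.analyticRank = 0) (hO : ClassO6 W 3) (hirr : W.HasIrreducibleModPGaloisRep 3)
    (W' : WeierstrassCurve ℚ) [W'.IsElliptic] [W'.IsGloballyMinimal] (hcong : ModPCongruent W' W 3)
    (hgood' : W'.HasGoodReductionAtPrime 3) (hap' : W'.frobeniusTrace 3 = 0)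
    (hrank' : W'.mordellWeilRank = 0) (hsha' : Nat.card (AddCommGroup.primaryComponent W'.sha 3) = 1)
    (htam' : ¬ 3 ∣ W'.tamagawaProduct) :
    MissingUpperBoundAt W 3 :=
  WildFineSelmerSupersingularCMAnchor.missingUpperBoundAt_wild_of_conjA hKatoA hGZK hmod W hr hO hirr
    (WildFineSelmerCongruenceFact.conjA_of_modPCongruent hLS (by norm_num) hcong
      (conjA_rat_of_signedUnitData h12 hKim W' (by norm_num) hgood' hap' hrank' hsha' htam'))

/-- **The same with the anchor's data in PRINTED form**: `r_an(E′) = 0`, `3 ∤ #Ш(E′/ℚ)`,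
`3 ∤ ∏ c_ℓ(E′)`. [cite: BDKim2013, Cor. 3.15 (p. 199)] [cite: Kobayashi2003, Thm. 1.2]
[cite: LimSujatha2018, §3 Prop. 3.2] -/
theorem missingUpperBoundAt_wild_of_supersingularUnitAnchor_analytic
    (hLS : LimSujatha2018.prop32_fineSelmerDual_moduleFinite_iff_of_torsionIso)
    (hKatoA :
      Kato2004.rankZero_padicValNat_sha_add_padicValNat_tamagawa_le_of_additive_potGood_of_irreducible_of_fineSelmerDual_fg)
    (h12 : Kobayashi2003.thm12_signedSelmerDual_finite_torsion)
    (hKim : BDKim2013.cor315_signedCharValue_rankZero)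
    (hGZK : rank_eq_analyticRank_of_analyticRank_le_one) (hmod : hasEntireLFunction_rat)
    (W : WeierstrassCurve ℚ) [W.IsElliptic] [W.IsGloballyMinimal] [Fact (3 : ℕ).Prime]
    (hr : W.analyticRank = 0) (hO : ClassO6 W 3) (hirr : W.HasIrreducibleModPGaloisRep 3)
    (W' : WeierstrassCurve ℚ) [W'.IsElliptic] [W'.IsGloballyMinimal] (hcong : ModPCongruent W' W 3)
    (hgood' : W'.HasGoodReductionAtPrime 3) (hap' : W'.frobeniusTrace 3 = 0)
    (hr' : W'.analyticRank = 0) (hsha' : ¬ 3 ∣ Nat.card W'.sha) (htam' : ¬ 3 ∣ W'.tamagawaProduct) :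
    MissingUpperBoundAt W 3 := by
  obtain ⟨hmw, hfin⟩ := hGZK W' (by rw [hr']; exact zero_le_one)
  haveI : Finite W'.sha := hfin
  have hrank' : W'.mordellWeilRank = 0 := by rw [hmw, hr']
  have h1 : Nat.card (AddCommGroup.primaryComponent W'.sha 3) = 1 := by
    rw [card_addPrimaryComponent_eq_pow 3, Nat.factorization_eq_zero_of_not_dvd hsha', pow_zero]
  exact missingUpperBoundAt_wild_of_supersingularUnitAnchor hLS hKatoA h12 hKim hGZK hmod W hr hO hirr
    W' hcong hgood' hap' hrank' h1 htam'

/-- **The SMALL-CONDUCTOR form** (`N_{E′} < 5000`): the `Ш`-certificate of the anchor is ONE exact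
`L`-value datum `Ш_an(E′) = m` with `3 ∤ m`, `Ш(E′)` being finite of order `Ш_an(E′)` by Creutz–Miller
(bsd.S31, `hS31`; g4's `natCard_sha_eq_of_conductor_lt_of_shaAn_eq`). [cite: CreutzMiller2012, Thm. 1.1]
[cite: BDKim2013, Cor. 3.15 (p. 199)] [cite: LimSujatha2018, §3 Prop. 3.2] -/
theorem missingUpperBoundAt_wild_of_smallConductorSupersingularUnitAnchor
    (hLS : LimSujatha2018.prop32_fineSelmerDual_moduleFinite_iff_of_torsionIso)
    (hKatoA :
      Kato2004.rankZero_padicValNat_sha_add_padicValNat_tamagawa_le_of_additive_potGood_of_irreducible_of_fineSelmerDual_fg)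
    (h12 : Kobayashi2003.thm12_signedSelmerDual_finite_torsion)
    (hKim : BDKim2013.cor315_signedCharValue_rankZero)
    (hGZK : rank_eq_analyticRank_of_analyticRank_le_one) (hmod : hasEntireLFunction_rat)
    (hS31 : bsdTriple_of_rank_le_one_of_conductor_lt)
    (W : WeierstrassCurve ℚ) [W.IsElliptic] [W.IsGloballyMinimal] [Fact (3 : ℕ).Prime]
    (hr : W.analyticRank = 0) (hO : ClassO6 W 3) (hirr : W.HasIrreducibleModPGaloisRep 3)
    (W' : WeierstrassCurve ℚ) [W'.IsElliptic] [W'.IsGloballyMinimal] (hcong : ModPCongruent W' W 3)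
    (hgood' : W'.HasGoodReductionAtPrime 3) (hap' : W'.frobeniusTrace 3 = 0)
    (hN' : W'.conductorNorm ℤ < 5000) (hrank' : W'.mordellWeilRank = 0)
    {m : ℕ} (hshaAn' : shaAn W' = (m : ℂ)) (hm : ¬ 3 ∣ m) (htam' : ¬ 3 ∣ W'.tamagawaProduct) :
    MissingUpperBoundAt W 3 := by
  obtain ⟨hfin, hcard⟩ :=
    WildFineSelmerSmallConductorAnchor.natCard_sha_eq_of_conductor_lt_of_shaAn_eq hS31 W'
      (by rw [hrank']; exact zero_le_one) hN' hshaAn'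
  haveI : Finite W'.sha := hfin
  have h1 : Nat.card (AddCommGroup.primaryComponent W'.sha 3) = 1 := by
    rw [card_addPrimaryComponent_eq_pow 3, hcard, Nat.factorization_eq_zero_of_not_dvd hm, pow_zero]
  exact missingUpperBoundAt_wild_of_supersingularUnitAnchor hLS hKatoA h12 hKim hGZK hmod W hr hO hirr
    W' hcong hgood' hap' hrank' h1 htam'

/-- **The crux body from per-row SUPERSINGULAR unit-anchor certificates** (class form; the `hcert`
currency for the census seats): if every ♯ row of `WildFineSelmerCoatesSujatha` (item 19386) admits ONE
congruent globally minimal good-supersingular `a₃ = 0` anchor with the three integers, the BODY of the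
route decl holds verbatim — via g3's `WildFineSelmerCongruenceFact.wildFineSelmerCoatesSujatha_of_mixedCertificates`
(its (A)-disjunct, fed by `conjA_rat_of_signedUnitData`). Conditional; the item is NOT closed.
[cite: BDKim2013, Cor. 3.15 (p. 199)] [cite: Kobayashi2003, Thm. 1.2] [cite: LimSujatha2018, §3 Prop. 3.2] -/
theorem wildFineSelmerCoatesSujatha_of_supersingularUnitAnchorCertificates
    (hLS : LimSujatha2018.prop32_fineSelmerDual_moduleFinite_iff_of_torsionIso)
    (h12 : Kobayashi2003.thm12_signedSelmerDual_finite_torsion)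
    (hKim : BDKim2013.cor315_signedCharValue_rankZero)
    (hcert : ∀ (W : WeierstrassCurve ℚ) [W.IsElliptic] [W.IsGloballyMinimal] [Fact (3 : ℕ).Prime],
      W.analyticRank = 0 → ClassO6 W 3 → W.HasIrreducibleModPGaloisRep 3 →
      ¬ (∀ n : ℕ, W.HasSurjectiveModNGaloisRep (3 ^ n : ℕ)) → ¬ W.HasCM →
      ∃ (W' : WeierstrassCurve ℚ) (_ : W'.IsElliptic) (_ : W'.IsGloballyMinimal),
        ModPCongruent W' W 3 ∧ W'.HasGoodReductionAtPrime 3 ∧ W'.frobeniusTrace 3 = 0 ∧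
        W'.mordellWeilRank = 0 ∧ Nat.card (AddCommGroup.primaryComponent W'.sha 3) = 1 ∧
        ¬ 3 ∣ W'.tamagawaProduct) :
    ∀ (W : WeierstrassCurve ℚ) [W.IsElliptic] [W.IsGloballyMinimal] [Fact (3 : ℕ).Prime],
      W.analyticRank = 0 → ClassO6 W 3 → W.HasIrreducibleModPGaloisRep 3 →
      ¬ (∀ n : ℕ, W.HasSurjectiveModNGaloisRep (3 ^ n : ℕ)) → ¬ W.HasCM →
      ∀ (κ : ZpExtension ℚ 3), κ.IsCyclotomic →
        ∃ (γ : absoluteGaloisGroup ℚ) (D : W.FineSelmerDualData κ γ),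
          Module.Finite ℤ_[3] (RestrictScalars ℤ_[3] (IwasawaAlgebra 3) D.X) := by
  refine WildFineSelmerCongruenceFact.wildFineSelmerCoatesSujatha_of_mixedCertificates hLS
    fun W _ _ _ hr hO hirr hns hcm ↦ ?_
  obtain ⟨W', hW'e, hW'm, hcong, hgood', hap', hrank', hsha', htam'⟩ := hcert W hr hO hirr hns hcm
  haveI := hW'e
  haveI := hW'm
  exact ⟨W', hW'e, hcong, Or.inl
    (conjA_rat_of_signedUnitData h12 hKim W' (by norm_num) hgood' hap' hrank' hsha' htam')⟩

end Summit.BirchSwinnertonDyer.BirchSwinnertonDyer.Theorems.WildFineSelmerSupersingularUnitAnchor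

end
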